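import Summits.QuantumFields.BalabanUV.Beta.FP.GenericResolventSandwich

/-!
# `BalabanUV.Beta.FP.ScaledResolventSandwichLetters` — road «FP» for binder row D1, W-ORACLE-K row **TRANSPORT** (§11d; first refusal leaf-02), located piece
# (T-alg) of L-d1leaf02g15-1, LETTERS HALF: DILATION TO THE `L`-SUBLATTICE PRESERVES THE SANDWICH DATA — superpositions, vertices, bi-vertices, decay,
# block covariance, `AbsMoment₂` columns, localisation of stencil and bi-stencil families (`Function.extend` along `u ↦ L•u`, `tsum_extend_zero`)

HONEST DEPENDENCY (page 1, mandatory): continuum YM on T⁴ ⇐ BetaPertH ∧ nine spine estimates (0/9 proved); BetaPertH ⇐ (D1) ∧ (D4) ∧ CAP+tail;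
G-an2-4 gates asym, D1 and NE2/3/4.  HONEST FRAMING (cell contract, verbatim): «discharging `BetaPertH` makes Bałaban's UV stability UNCONDITIONAL —
a real constructive-QFT result; it is NOT the continuum limit and NOT the Clay problem.»  THIS MODULE is [folklore] re-indexing bookkeeping for absolutely convergent
superpositions over an4's `colH`∕`vertexOfK`, an1's `vertex2OfK`, an2∕asym1's `ExpKernelCalculus` letters; GENERIC kernels — nothing of the perfect objects
instantiated.  No `def`, no `def … : Prop`, nothing cited, 0 sorry; 0∕4 row-D1 binders; NOT TRANSPORT, NOT SDF, NOT D1, NOT BetaPertH, NOT continuum, NOT Clay.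
«not in print; our bookkeeping».

ABSOLUTE RULE (cell charter, verbatim): «No internally-minted statement may enter as a cited fact. Every hypothesis is either kernel-proved in this package or a
verbatim quotation of a PUBLISHED theorem with page reference. The manuscript(s) under audit are NOT citable for their own disputed steps — they are the thing
under adjudication; programme-internal (2001/route/tribunal) claims are never citable.»

WHY (memo `N2B-DESIGN.md` §11 (11d); L-d1leaf02g15-1 l.35286; `ColumnSemigroupVertexNesting` (F-V)).  After (F-V) the level-`(m+1)` vertex is
`vertexOfK (KPerf m) (Lc^m) V₁` with `V₁ := vertexOfK G₁ Lc S∞` — a «stencil family» indexed by the `Lc`-LATTICE coordinates `u` of its bonds but localised at the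
FINE points `Lc•u`; the landed N0-sandwich (`GenericResolventSandwich`) wants stencils localised at their own index (`L = 1`).  Dilating the index
(`V₁♯ (L•u) := V₁ u`, zero off the sublattice; `C♯ (L•u) (L•w) := C u w`) restores the landed hypotheses verbatim with blocking `n·L`; this file is that
bookkeeping, the companion `FP/ScaledResolventSandwich` un-dilates both sides and states the sandwich one lattice up.
CONTENT ([folklore]; `d + 1 = 4`): `zsmul_injective`, `pair_injective`, `not_exists_of_not_range`, **`wsum_extend`** (`wsum w♯ S♯ = wsum w S`),
**`vertexOfK_of_colH_extend`**, **`vertex2OfK_of_colH_extend`** (dilated columns ⇒ same vertex ∕ bi-vertex), `natMul_zsmul`, **`colH_extend₂`**, `colOf_extend₂`,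
**`decays_extend₂`** (rate `δ∕L`), **`shiftK_extend₂`**, **`absMoment₂_extend`**, **`locStencil_extend`**, `shift_extend`, **`biLoc_extend₂`**, `shift_extend₂`.
Provenance: unit `b2b-balaban-beta-d1-formalise-leaf-02` gen 15 (prover-b2b-balaban-beta-d1-formalise-leaf-02-g15-0), 2026-08-21; new file, nothing appended to others' modules.
-/

noncomputable section

namespace Summit.QuantumFields.BalabanUV.Beta.FP.ScaledResolventSandwichLetters

open Finset Filter Topology
open scoped BigOperators
open Literature.MathematicalPhysics.QuantumFieldTheory.Balaban1983to89
open Literature.MathematicalPhysics.QuantumFieldTheory.Balaban1983to89.Beta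
open B12Sec2to5 (l1 l1_nonneg)
open ExpKernelCalculus (Site MKer Decays BiLoc comp tr bubble tadpole hessKer shiftK l1_natSmul)
open DecimatedMomentSummable (AbsMoment₂)
open OneStepResolventKernel (Fib wsum LocStencil)
open OneStepKernelFamily (colH vertexOfK)
open SecondOrderResponse (vertex2OfK)
open Summit.QuantumFields.BalabanUV.Beta.TameKernelCalculus (Spr)
open Summit.QuantumFields.BalabanUV.Beta.D1BFx.MomentTransferPeriodicSum (dressedSumP)
open Summit.QuantumFields.BalabanUV.Beta.D1BFx.MomentTransferPeriodicEntry (EKer₂ dressedEntryP)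
open Summit.QuantumFields.BalabanUV.Beta.D1BFx.DressedTablesLeg (tadpoleTableA_apply bubbleTableA_apply)
open Summit.QuantumFields.BalabanUV.Beta.D1BFx.ReducedKernelSandwichLeg (fineHessA fineHessA_apply)
open Summit.QuantumFields.BalabanUV.Beta.FP.TransportInfinityM (colOf)
open Summit.QuantumFields.BalabanUV.Beta.FP.GenericResolventSandwich (hessKer_vertexOfK_vertex2OfK_eq_dressedEntryP)

variable {L : ℕ} [NeZero L]

/-! ## §1 Dilation to the `L`-sublattice -/

/-- [folklore] `u ↦ L•u` is injective on `ℤ⁴` (`L ≠ 0`). -/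
theorem zsmul_injective : Function.Injective (fun u : Site (3 + 1) => (L : ℤ) • u) := by
  have hL : (L : ℤ) ≠ 0 := by exact_mod_cast NeZero.ne L
  exact smul_right_injective (Site (3 + 1)) hL

/-- [folklore] `(u, u′) ↦ (L•u, L•u′)` is injective. -/
theorem pair_injective :
    Function.Injective (fun q : Site (3 + 1) × Site (3 + 1) => ((L : ℤ) • q.1, (L : ℤ) • q.2)) := by
  intro p q h
  simp only [Prod.mk.injEq] at h
  exact Prod.ext (zsmul_injective (L := L) h.1) (zsmul_injective (L := L) h.2)

omit [NeZero L] in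
/-- [folklore] Off the sublattice, so is every `L•t`-translate. -/
theorem not_exists_of_not_range {v : Site (3 + 1)} (hv : ¬∃ u : Site (3 + 1), (L : ℤ) • u = v) (t : Site (3 + 1)) :
    ¬∃ u : Site (3 + 1), (L : ℤ) • u = v + (L : ℤ) • t := by
  rintro ⟨u, hu⟩
  exact hv ⟨u - t, by rw [smul_sub, hu, add_sub_cancel_right]⟩

/-- [folklore] **DILATION PRESERVES THE WEIGHTED SUPERPOSITION**: `wsum w♯ S♯ = wsum w S` for `w♯ := extend (L•·) w 0`, `S♯ := extend (L•·) S 0`. -/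
theorem wsum_extend (w : Site (3 + 1) → ℝ) (S : Site (3 + 1) → MKer (3 + 1) (Fib 3)) :
    wsum (Function.extend (fun u : Site (3 + 1) => (L : ℤ) • u) w 0) (Function.extend (fun u : Site (3 + 1) => (L : ℤ) • u) S 0) = wsum w S := by
  funext x z a b
  simp only [wsum]
  rw [← tsum_extend_zero (zsmul_injective (L := L)) (fun u => w u * S u x z a b)]
  refine tsum_congr fun v => ?_
  by_cases hv : ∃ u : Site (3 + 1), (L : ℤ) • u = v
  · obtain ⟨u, rfl⟩ := hv
    rw [(zsmul_injective (L := L)).extend_apply, (zsmul_injective (L := L)).extend_apply, (zsmul_injective (L := L)).extend_apply]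
  · rw [Function.extend_apply' _ _ _ hv, Function.extend_apply' _ _ _ hv, Function.extend_apply' _ _ _ hv]
    simp

section Vertex

variable {n : ℕ} {C K' : MKer (3 + 1) (Fib 3)}

/-- [folklore] **THE DILATED VERTEX IS THE VERTEX**: if the `n·L`-columns of `K′` are the dilated `n`-columns of `C`
(`colH K′ (n·L) μ y κ = extend (L•·) (colH C n μ y κ) 0`), then `vertexOfK K′ (n·L) S♯ = vertexOfK C n S` for `S♯ κ := extend (L•·) (S κ) 0`. -/
theorem vertexOfK_of_colH_extend
    (hK' : ∀ (μ : Fin (3 + 1)) (y : Site (3 + 1)) (κ : Fin (3 + 1)),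
      colH K' (n * L) μ y κ = Function.extend (fun u : Site (3 + 1) => (L : ℤ) • u) (colH C n μ y κ) 0)
    (S : Fin (3 + 1) → Site (3 + 1) → MKer (3 + 1) (Fib 3)) (μ : Fin (3 + 1)) (y : Site (3 + 1)) :
    vertexOfK K' (n * L) (fun κ => Function.extend (fun u : Site (3 + 1) => (L : ℤ) • u) (S κ) 0) μ y = vertexOfK C n S μ y := by
  funext x z a b
  simp only [vertexOfK]
  refine Finset.sum_congr rfl fun κ _ => ?_
  rw [hK' μ y κ, wsum_extend]

/-- [folklore] **THE DILATED BI-VERTEX IS THE BI-VERTEX**: with `S₂♯ κ v l x := extend ((u,u′) ↦ (L•u, L•u′)) ((u,u′) ↦ S₂ κ u l u′) 0 (v, x)`,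
`vertex2OfK K′ (n·L) S₂♯ = vertex2OfK C n S₂`. -/
theorem vertex2OfK_of_colH_extend
    (hK' : ∀ (μ : Fin (3 + 1)) (y : Site (3 + 1)) (κ : Fin (3 + 1)),
      colH K' (n * L) μ y κ = Function.extend (fun u : Site (3 + 1) => (L : ℤ) • u) (colH C n μ y κ) 0)
    (S₂ : Fin (3 + 1) → Site (3 + 1) → Fin (3 + 1) → Site (3 + 1) → MKer (3 + 1) (Fib 3))
    (μ : Fin (3 + 1)) (y : Site (3 + 1)) (ν : Fin (3 + 1)) (y' : Site (3 + 1)) :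
    vertex2OfK K' (n * L) (fun κ v l x => Function.extend (fun q : Site (3 + 1) × Site (3 + 1) => ((L : ℤ) • q.1, (L : ℤ) • q.2))
        (fun q => S₂ κ q.1 l q.2) 0 (v, x)) μ y ν y'
      = vertex2OfK C n S₂ μ y ν y' := by
  unfold vertex2OfK
  -- the inner family is the dilation of the inner vertices
  have hin : (fun κ v => vertexOfK K' (n * L) (fun l x => Function.extend
        (fun q : Site (3 + 1) × Site (3 + 1) => ((L : ℤ) • q.1, (L : ℤ) • q.2)) (fun q => S₂ κ q.1 l q.2) 0 (v, x)) ν y')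
      = fun κ => Function.extend (fun u : Site (3 + 1) => (L : ℤ) • u) (fun u => vertexOfK C n (S₂ κ u) ν y') 0 := by
    funext κ v
    by_cases hv : ∃ u : Site (3 + 1), (L : ℤ) • u = v
    · obtain ⟨u, rfl⟩ := hv
      rw [(zsmul_injective (L := L)).extend_apply]
      have e : (fun l x => Function.extend (fun q : Site (3 + 1) × Site (3 + 1) => ((L : ℤ) • q.1, (L : ℤ) • q.2))
            (fun q => S₂ κ q.1 l q.2) 0 ((L : ℤ) • u, x))
          = fun l => Function.extend (fun u' : Site (3 + 1) => (L : ℤ) • u') (S₂ κ u l) 0 := by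
        funext l x
        by_cases hx : ∃ u' : Site (3 + 1), (L : ℤ) • u' = x
        · obtain ⟨u', rfl⟩ := hx
          rw [(zsmul_injective (L := L)).extend_apply]
          exact (pair_injective (L := L)).extend_apply (fun q => S₂ κ q.1 l q.2) 0 (u, u')
        · rw [Function.extend_apply' _ _ _ hx, Function.extend_apply' _ _ _ ?_]
          · rfl
          · rintro ⟨q, hq⟩
            simp only [Prod.mk.injEq] at hq
            exact hx ⟨q.2, hq.2⟩
      rw [e, vertexOfK_of_colH_extend hK']
    · rw [Function.extend_apply' _ _ _ hv]
      have e : (fun l x => Function.extend (fun q : Site (3 + 1) × Site (3 + 1) => ((L : ℤ) • q.1, (L : ℤ) • q.2))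
            (fun q => S₂ κ q.1 l q.2) 0 (v, x)) = fun l x => (0 : MKer (3 + 1) (Fib 3)) := by
        funext l x
        rw [Function.extend_apply' _ _ _ ?_]
        · rfl
        · rintro ⟨q, hq⟩
          simp only [Prod.mk.injEq] at hq
          exact hv ⟨q.1, hq.1⟩
      rw [e]
      funext x z a b
      simp only [vertexOfK, wsum, Pi.zero_apply, mul_zero, tsum_zero, Finset.sum_const_zero]
  rw [hin]
  exact vertexOfK_of_colH_extend hK' _ μ y

end Vertex

section Letters

variable {n : ℕ} {C : MKer (3 + 1) (Fib 3)} {CC δ : ℝ}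

omit [NeZero L] in
/-- [folklore] `((n·L : ℕ) : ℤ)•y = L•(n•y)`. -/
theorem natMul_zsmul (y : Site (3 + 1)) : (((n * L : ℕ) : ℤ)) • y = (L : ℤ) • ((n : ℤ) • y) := by
  rw [smul_smul, mul_comm]
  push_cast
  rfl

/-- [folklore] **THE COLUMNS OF THE DILATED KERNEL ARE THE DILATED COLUMNS**: for `C♯ v w := extend ((u,u′) ↦ (L•u, L•u′)) ((u,u′) ↦ C u u′) 0 (v, w)`,
`colH C♯ (n·L) μ y κ = extend (L•·) (colH C n μ y κ) 0`. -/
theorem colH_extend₂ (μ : Fin (3 + 1)) (y : Site (3 + 1)) (κ : Fin (3 + 1)) :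
    colH (fun v w => Function.extend (fun q : Site (3 + 1) × Site (3 + 1) => ((L : ℤ) • q.1, (L : ℤ) • q.2))
        (fun q => C q.1 q.2) 0 (v, w)) (n * L) μ y κ
      = Function.extend (fun u : Site (3 + 1) => (L : ℤ) • u) (colH C n μ y κ) 0 := by
  funext v
  simp only [colH]
  rw [natMul_zsmul]
  by_cases hv : ∃ u : Site (3 + 1), (L : ℤ) • u = v
  · obtain ⟨u, rfl⟩ := hv
    rw [(zsmul_injective (L := L)).extend_apply]
    exact congrFun (congrFun ((pair_injective (L := L)).extend_apply (fun q => C q.1 q.2) 0 (u, (n : ℤ) • y)) (Sum.inl κ)) (Sum.inr μ)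
  · rw [Function.extend_apply' _ _ _ hv, Function.extend_apply' _ _ _ ?_]
    · rfl
    · rintro ⟨q, hq⟩
      simp only [Prod.mk.injEq] at hq
      exact hv ⟨q.1, hq.1⟩

/-- [folklore] The `colOf` column of the dilated kernel is the dilated `colOf` column. -/
theorem colOf_extend₂ (κ l : Fin 4) :
    colOf (fun v w => Function.extend (fun q : Site (3 + 1) × Site (3 + 1) => ((L : ℤ) • q.1, (L : ℤ) • q.2))
        (fun q => C q.1 q.2) 0 (v, w)) κ l
      = Function.extend (fun u : Site (3 + 1) => (L : ℤ) • u) (colOf C κ l) 0 := by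
  funext p
  simp only [colOf]
  by_cases hp : ∃ u : Site (3 + 1), (L : ℤ) • u = p
  · obtain ⟨u, rfl⟩ := hp
    rw [(zsmul_injective (L := L)).extend_apply]
    have e : (-((L : ℤ) • u), (0 : Site (3 + 1))) = ((L : ℤ) • (-u), (L : ℤ) • (0 : Site (3 + 1))) := by
      rw [smul_neg, smul_zero]
    rw [e]
    exact congrFun (congrFun ((pair_injective (L := L)).extend_apply (fun q => C q.1 q.2) 0 (-u, 0)) (Sum.inl κ)) (Sum.inr l)
  · rw [Function.extend_apply' _ _ _ hp, Function.extend_apply' _ _ _ ?_]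
    · rfl
    · rintro ⟨q, hq⟩
      simp only [Prod.mk.injEq] at hq
      exact hp ⟨-q.1, by rw [smul_neg, hq.1, neg_neg]⟩

/-- [folklore] **DILATION PRESERVES DECAY** (rate `δ ∕ L`): `Decays C CC δ` ⇒ `Decays C♯ CC (δ ∕ L)`. -/
theorem decays_extend₂ (hC : Decays C CC δ) :
    Decays (fun v w => Function.extend (fun q : Site (3 + 1) × Site (3 + 1) => ((L : ℤ) • q.1, (L : ℤ) • q.2))
        (fun q => C q.1 q.2) 0 (v, w)) CC (δ / L) := by
  have hCC : 0 ≤ CC := hC.nonneg (Sum.inl 0)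
  have hL : (L : ℝ) ≠ 0 := by exact_mod_cast NeZero.ne L
  intro v w a b
  dsimp only
  by_cases hq : ∃ q : Site (3 + 1) × Site (3 + 1), ((L : ℤ) • q.1, (L : ℤ) • q.2) = (v, w)
  · obtain ⟨q, hq⟩ := hq
    simp only [Prod.mk.injEq] at hq
    obtain ⟨hq1, hq2⟩ := hq
    subst hq1 hq2
    rw [(pair_injective (L := L)).extend_apply (fun q => C q.1 q.2) 0 q]
    refine (hC q.1 q.2 a b).trans (le_of_eq ?_)
    rw [← smul_sub, l1_natSmul]
    congr 1
    field_simp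
  · rw [Function.extend_apply' _ _ _ hq]
    simp only [Pi.zero_apply, abs_zero]
    positivity

/-- [folklore] **DILATION PRESERVES BLOCK COVARIANCE**: `shiftK (−(n•t)) C = C` for all `t` ⇒ `shiftK (−((n·L)•t)) C♯ = C♯` for all `t`. -/
theorem shiftK_extend₂ (hCcov : ∀ t : Site (3 + 1), shiftK (-((n : ℤ) • t)) C = C) (t : Site (3 + 1)) :
    shiftK (-(((n * L : ℕ) : ℤ) • t)) (fun v w => Function.extend (fun q : Site (3 + 1) × Site (3 + 1) => ((L : ℤ) • q.1, (L : ℤ) • q.2))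
        (fun q => C q.1 q.2) 0 (v, w))
      = fun v w => Function.extend (fun q : Site (3 + 1) × Site (3 + 1) => ((L : ℤ) • q.1, (L : ℤ) • q.2))
        (fun q => C q.1 q.2) 0 (v, w) := by
  funext v w
  show Function.extend (fun q : Site (3 + 1) × Site (3 + 1) => ((L : ℤ) • q.1, (L : ℤ) • q.2)) (fun q => C q.1 q.2) 0
      (v + -(((n * L : ℕ) : ℤ) • t), w + -(((n * L : ℕ) : ℤ) • t))
    = Function.extend (fun q : Site (3 + 1) × Site (3 + 1) => ((L : ℤ) • q.1, (L : ℤ) • q.2)) (fun q => C q.1 q.2) 0 (v, w)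
  rw [natMul_zsmul]
  by_cases hq : ∃ q : Site (3 + 1) × Site (3 + 1), ((L : ℤ) • q.1, (L : ℤ) • q.2) = (v, w)
  · obtain ⟨q, hq⟩ := hq
    simp only [Prod.mk.injEq] at hq
    obtain ⟨hq1, hq2⟩ := hq
    subst hq1 hq2
    have e : ((L : ℤ) • q.1 + -((L : ℤ) • ((n : ℤ) • t)), (L : ℤ) • q.2 + -((L : ℤ) • ((n : ℤ) • t)))
        = ((L : ℤ) • (q.1 + -((n : ℤ) • t)), (L : ℤ) • (q.2 + -((n : ℤ) • t))) := by
      rw [smul_add, smul_add, smul_neg]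
    rw [e, (pair_injective (L := L)).extend_apply (fun q => C q.1 q.2) 0 (q.1 + -((n : ℤ) • t), q.2 + -((n : ℤ) • t)),
      (pair_injective (L := L)).extend_apply (fun q => C q.1 q.2) 0 q]
    have h := hCcov t
    exact congrFun (congrFun h q.1) q.2
  · rw [Function.extend_apply' _ _ _ hq, Function.extend_apply' _ _ _ ?_]
    · rfl
    · rintro ⟨q, hq'⟩
      simp only [Prod.mk.injEq] at hq'
      refine hq ⟨(q.1 + (n : ℤ) • t, q.2 + (n : ℤ) • t), ?_⟩
      simp only [Prod.mk.injEq, smul_add]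
      constructor
      · rw [hq'.1]; abel
      · rw [hq'.2]; abel

/-- [folklore] **DILATION PRESERVES `AbsMoment₂`** (`L ≥ 1`): `AbsMoment₂ f` ⇒ `AbsMoment₂ (extend (L•·) f 0)`. -/
theorem absMoment₂_extend {f : Site (3 + 1) → ℝ} (hf : AbsMoment₂ f) :
    AbsMoment₂ (Function.extend (fun u : Site (3 + 1) => (L : ℤ) • u) f 0) := by
  unfold DecimatedMomentSummable.AbsMoment₂ at hf ⊢
  have hL1 : (1 : ℝ) ≤ L := by exact_mod_cast Nat.one_le_iff_ne_zero.mpr (NeZero.ne L)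
  have hzero : ∀ v ∉ Set.range (fun u : Site (3 + 1) => (L : ℤ) • u),
      (fun v => (1 + l1 v ^ 2) * |Function.extend (fun u : Site (3 + 1) => (L : ℤ) • u) f 0 v|) v = 0 := by
    intro v hv
    simp only [Function.extend_apply' _ _ _ hv, Pi.zero_apply, abs_zero, mul_zero]
  refine ((zsmul_injective (L := L)).summable_iff hzero).mp ?_
  refine Summable.of_nonneg_of_le (fun u => mul_nonneg (by positivity) (abs_nonneg _)) (fun u => ?_) (hf.mul_left ((L : ℝ) ^ 2))
  simp only [Function.comp_apply, (zsmul_injective (L := L)).extend_apply, l1_natSmul]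
  have h1 : 0 ≤ l1 u := l1_nonneg u
  have h2 : 1 + ((L : ℝ) * l1 u) ^ 2 ≤ (L : ℝ) ^ 2 * (1 + l1 u ^ 2) := by nlinarith [sq_nonneg (l1 u)]
  calc (1 + ((L : ℝ) * l1 u) ^ 2) * |f u| ≤ (L : ℝ) ^ 2 * (1 + l1 u ^ 2) * |f u| := by gcongr
    _ = (L : ℝ) ^ 2 * ((1 + l1 u ^ 2) * |f u|) := by ring

end Letters

section Tables

variable {n : ℕ} {V₁ : Fin (3 + 1) → Site (3 + 1) → MKer (3 + 1) (Fib 3)}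
  {W₁ : Fin (3 + 1) → Site (3 + 1) → Fin (3 + 1) → Site (3 + 1) → MKer (3 + 1) (Fib 3)} {Cs δs C2 δ2 : ℝ}

/-- [folklore] **THE DILATED VERTEX FAMILY IS A LOCAL STENCIL FAMILY**: `BiLoc (V₁ κ u) (L•u) (L•u) Cs δs` for all `κ u` ⇒ `LocStencil V₁♯ Cs δs`. -/
theorem locStencil_extend (hV : ∀ κ u, BiLoc (V₁ κ u) ((L : ℤ) • u) ((L : ℤ) • u) Cs δs) :
    LocStencil (fun κ => Function.extend (fun u : Site (3 + 1) => (L : ℤ) • u) (V₁ κ) 0) Cs δs := by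
  have hCs : 0 ≤ Cs := (hV 0 0).nonneg (Sum.inl 0)
  intro κ v
  dsimp only
  by_cases hv : ∃ u : Site (3 + 1), (L : ℤ) • u = v
  · obtain ⟨u, rfl⟩ := hv
    rw [(zsmul_injective (L := L)).extend_apply]
    exact hV κ u
  · rw [Function.extend_apply' _ _ _ hv]
    intro x z a b
    simp only [Pi.zero_apply, abs_zero]
    positivity

/-- [folklore] **… AND BLOCK-COVARIANT** at blocking `n·L` when `V₁ κ (u + n•t) = shiftK (−((n·L)•t)) (V₁ κ u)`. -/
theorem shift_extend (hVcov : ∀ κ u t, V₁ κ (u + (n : ℤ) • t) = shiftK (-(((n * L : ℕ) : ℤ) • t)) (V₁ κ u))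
    (κ : Fin (3 + 1)) (v t : Site (3 + 1)) :
    Function.extend (fun u : Site (3 + 1) => (L : ℤ) • u) (V₁ κ) 0 (v + (((n * L : ℕ) : ℤ)) • t)
      = shiftK (-(((n * L : ℕ) : ℤ) • t)) (Function.extend (fun u : Site (3 + 1) => (L : ℤ) • u) (V₁ κ) 0 v) := by
  by_cases hv : ∃ u : Site (3 + 1), (L : ℤ) • u = v
  · obtain ⟨u, rfl⟩ := hv
    have e : (L : ℤ) • u + (((n * L : ℕ) : ℤ)) • t = (L : ℤ) • (u + (n : ℤ) • t) := by rw [natMul_zsmul, smul_add]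
    rw [e, (zsmul_injective (L := L)).extend_apply, (zsmul_injective (L := L)).extend_apply]
    exact hVcov κ u t
  · have hv' : ¬∃ u : Site (3 + 1), (L : ℤ) • u = v + (((n * L : ℕ) : ℤ)) • t := by
      rw [natMul_zsmul]
      exact not_exists_of_not_range hv _
    rw [Function.extend_apply' _ _ _ hv, Function.extend_apply' _ _ _ hv']
    rfl

/-- [folklore] **THE DILATED BI-FAMILY IS BI-LOCALISED AT ITS OWN INDICES**: `BiLoc (W₁ κ u l u′) (L•u) (L•u′) C2 δ2` ⇒ `BiLoc (W₁♯ κ v l x) v x C2 δ2`. -/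
theorem biLoc_extend₂ (hW : ∀ κ u l u', BiLoc (W₁ κ u l u') ((L : ℤ) • u) ((L : ℤ) • u') C2 δ2)
    (κ : Fin (3 + 1)) (v : Site (3 + 1)) (l : Fin (3 + 1)) (x : Site (3 + 1)) :
    BiLoc (Function.extend (fun q : Site (3 + 1) × Site (3 + 1) => ((L : ℤ) • q.1, (L : ℤ) • q.2)) (fun q => W₁ κ q.1 l q.2) 0 (v, x))
      v x C2 δ2 := by
  have hC2 : 0 ≤ C2 := (hW 0 0 0 0).nonneg (Sum.inl 0)
  by_cases hq : ∃ q : Site (3 + 1) × Site (3 + 1), ((L : ℤ) • q.1, (L : ℤ) • q.2) = (v, x)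
  · obtain ⟨q, hq⟩ := hq
    simp only [Prod.mk.injEq] at hq
    obtain ⟨hq1, hq2⟩ := hq
    subst hq1 hq2
    rw [(pair_injective (L := L)).extend_apply (fun q => W₁ κ q.1 l q.2) 0 q]
    exact hW κ q.1 l q.2
  · rw [Function.extend_apply' _ _ _ hq]
    intro x' z' a b
    simp only [Pi.zero_apply, abs_zero]
    positivity

/-- [folklore] **… AND JOINTLY BLOCK-COVARIANT** at blocking `n·L`. -/
theorem shift_extend₂ (hWcov : ∀ κ u l u' t, W₁ κ (u + (n : ℤ) • t) l (u' + (n : ℤ) • t) = shiftK (-(((n * L : ℕ) : ℤ) • t)) (W₁ κ u l u'))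
    (κ : Fin (3 + 1)) (v : Site (3 + 1)) (l : Fin (3 + 1)) (x t : Site (3 + 1)) :
    Function.extend (fun q : Site (3 + 1) × Site (3 + 1) => ((L : ℤ) • q.1, (L : ℤ) • q.2)) (fun q => W₁ κ q.1 l q.2) 0
        (v + (((n * L : ℕ) : ℤ)) • t, x + (((n * L : ℕ) : ℤ)) • t)
      = shiftK (-(((n * L : ℕ) : ℤ) • t)) (Function.extend (fun q : Site (3 + 1) × Site (3 + 1) => ((L : ℤ) • q.1, (L : ℤ) • q.2))
          (fun q => W₁ κ q.1 l q.2) 0 (v, x)) := by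
  by_cases hq : ∃ q : Site (3 + 1) × Site (3 + 1), ((L : ℤ) • q.1, (L : ℤ) • q.2) = (v, x)
  · obtain ⟨q, hq⟩ := hq
    simp only [Prod.mk.injEq] at hq
    obtain ⟨hq1, hq2⟩ := hq
    subst hq1 hq2
    have e : ((L : ℤ) • q.1 + (((n * L : ℕ) : ℤ)) • t, (L : ℤ) • q.2 + (((n * L : ℕ) : ℤ)) • t)
        = ((L : ℤ) • (q.1 + (n : ℤ) • t), (L : ℤ) • (q.2 + (n : ℤ) • t)) := by
      rw [natMul_zsmul, smul_add, smul_add]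
    rw [e, (pair_injective (L := L)).extend_apply (fun q => W₁ κ q.1 l q.2) 0 (q.1 + (n : ℤ) • t, q.2 + (n : ℤ) • t),
      (pair_injective (L := L)).extend_apply (fun q => W₁ κ q.1 l q.2) 0 q]
    exact hWcov κ q.1 l q.2 t
  · have hq' : ¬∃ q : Site (3 + 1) × Site (3 + 1), ((L : ℤ) • q.1, (L : ℤ) • q.2)
        = (v + (((n * L : ℕ) : ℤ)) • t, x + (((n * L : ℕ) : ℤ)) • t) := by
      rintro ⟨q, hq'⟩
      simp only [Prod.mk.injEq] at hq'
      refine hq ⟨(q.1 - (n : ℤ) • t, q.2 - (n : ℤ) • t), ?_⟩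
      simp only [Prod.mk.injEq, smul_sub]
      rw [hq'.1, hq'.2, natMul_zsmul]
      constructor <;> abel
    rw [Function.extend_apply' _ _ _ hq, Function.extend_apply' _ _ _ hq']
    rfl

end Tables

end Summit.QuantumFields.BalabanUV.Beta.FP.ScaledResolventSandwichLetters

end
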